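import Summits.QuantumFields.YangMills.Theorems.FlatTubeReductionProfileInterfaceMoment
import Summits.QuantumFields.YangMills.Theorems.FlatTubeReductionCoreTails
import Summits.QuantumFields.YangMills.Theorems.FlatTubeReductionReferenceFibreTail
import HarnessLib

/-!
# PROFILE INTERFACE, part 2: the REFERENCE TAIL `η₁` of the exact diagonal dressing from profile-number ratios — `∫_{S′(T)ᶜ}ρ₁ ≤ C_η·(e^{−T/2} + t)·∫ρ₁` whenever
# `I₀, M_{3n} ≤ A·θ` and the profile fibre tails `∫_{T<β‖v̂‖²}Ω, ∫_{T<β‖v̂‖²}Ω(√β‖v̂‖)^{3n} ≤ t·θ` (`θ = ∫_C Ω`, `C ⊆ {cap, ‖v̂‖, |v_{e,c}| ≤ β^{-1/2}}`, `β ≥ 900`)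
# (route `FlatTubeReduction`, crux K1 `NearFlatRatioLaw` stmt-QuantumFields-24720; seat `ym-line-ftr-p1` g14; rate twin «ratepack-v3 / frozen fibres»; R2b1 RECORD rung — no summit
# statement is proved here)

WHY (memo `Cruxes/NearFlatRatioLaw/Lines/ratepack-v3-frozen-g12.md` §6.1 (F8b)(iv); second of the three interface hypotheses of `…ExactDressing.exactDressing_fields`).
`reference_core_tail_le` splits `S′ᶜ` into the kinetic tail (`reference_tail_le`: relative `e^{−T/2}·κ`, `κ` β-free modulo `I₀/θ`, `M_{3n}/θ`) and the two fibre tails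
(`reference_fibre_tail_le`, `reference_fibre_tail_le'`: relative `κ'·(profile tail numbers)/θ²`); at `ρ = r₀ = t₀ = (√β)⁻¹` the factors `fpZ ε`, `K₁(1,1)` cancel, `(√β)^{-3n}/(ρ³/10)^n = 10^n` and
`c₁ ≥ c₁*` (`floorConst_le`).
* `tail_ratio_grouped`, `tail_ratio_flat` (the two coefficient shapes of the bricks against the floor), ★★★ `profile_reference_tail`.
HONEST FRAMING: bookkeeping of landed bricks; femto rung R2b1 (RECORD label); not infinite volume, not a gap, not Clay.  No defs, no named facts, no `sorry`.
-/

set_option autoImplicit false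

noncomputable section

open MeasureTheory Filter Topology Real Set
open scoped BigOperators
open Literature.MathematicalPhysics.QuantumFieldTheory
open Literature.MathematicalPhysics.QuantumLattice

namespace Summit.QuantumFields.YangMills.Theorems.FemtoTransferGap.RateTube

open Summit.QuantumFields.YangMills.Theorems.FemtoTransferGap
open Summit.QuantumFields.YangMills.Theorems.FemtoTransferGap.TwoLattice
open Summit.QuantumFields.YangMills.Theorems.FemtoTransferGap.TwoLattice.ConstTube
open Summit.QuantumFields.YangMills.Theorems.FemtoTransferGap.TwoLattice.Avg
open Summit.QuantumFields.YangMills.Theorems.FemtoTransferGap.TwoLattice.Cov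
open Summit.QuantumFields.YangMills.Theorems.FemtoTransferGap.TwoLattice.Stiff (LinkSpace)

/-! ## §1 The two coefficient shapes against the floor -/

section Scalar

/-- Grouped shape: `K·(Z·(abc·s^{3n})·W)/(c₁·(Z·(s³/10)^n·θ²)) ≤ K·abc·10^n·w/c₁*` when `W ≤ wθ²`, `c₁ ≥ c₁* > 0`. [folklore] -/
theorem tail_ratio_grouped {K Z a b c s θ W w c₁ cstar : ℝ} {n : ℕ} (hK : 0 ≤ K) (hZ : 0 < Z) (hs : 0 < s) (hθ : 0 < θ) (habc : 0 ≤ a * b * c) (hw : 0 ≤ w)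
    (hW : W ≤ w * θ ^ 2) (hcstar : 0 < cstar) (hc : cstar ≤ c₁) :
    K * (Z * (a * b * c * s ^ (3 * n)) * W) / (c₁ * (Z * (s ^ 3 / 10) ^ n * θ ^ 2)) ≤ K * (a * b * c) * 10 ^ n * w / cstar := by
  have hpow : (s ^ 3 / 10) ^ n * 10 ^ n = s ^ (3 * n) := by
    rw [← mul_pow, div_mul_cancel₀ _ (by norm_num : (10 : ℝ) ≠ 0), ← pow_mul]
  have hc₁ : 0 < c₁ := lt_of_lt_of_le hcstar hc
  have hden : 0 < c₁ * (Z * (s ^ 3 / 10) ^ n * θ ^ 2) := by positivity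
  rw [div_le_div_iff₀ hden hcstar]
  calc K * (Z * (a * b * c * s ^ (3 * n)) * W) * cstar ≤ K * (Z * (a * b * c * s ^ (3 * n)) * (w * θ ^ 2)) * c₁ :=
        mul_le_mul (mul_le_mul_of_nonneg_left (mul_le_mul_of_nonneg_left hW (by positivity)) hK) hc hcstar.le (by positivity)
    _ = K * (a * b * c) * 10 ^ n * w * (c₁ * (Z * (s ^ 3 / 10) ^ n * θ ^ 2)) := by rw [← hpow]; ring

/-- Flat shape: `K·(Z·a·b·c·s^{3n})·W/(c₁·(Z·(s³/10)^n·θ²)) ≤ K·abc·10^n·w/c₁*` when `W ≤ wθ²`, `c₁ ≥ c₁* > 0`. [folklore] -/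
theorem tail_ratio_flat {K Z a b c s θ W w c₁ cstar : ℝ} {n : ℕ} (hK : 0 ≤ K) (hZ : 0 < Z) (hs : 0 < s) (hθ : 0 < θ) (habc : 0 ≤ a * b * c) (hw : 0 ≤ w)
    (hW : W ≤ w * θ ^ 2) (hcstar : 0 < cstar) (hc : cstar ≤ c₁) :
    K * (Z * a * b * c * s ^ (3 * n)) * W / (c₁ * (Z * (s ^ 3 / 10) ^ n * θ ^ 2)) ≤ K * (a * b * c) * 10 ^ n * w / cstar := by
  have e : K * (Z * a * b * c * s ^ (3 * n)) * W = K * (Z * (a * b * c * s ^ (3 * n)) * W) := by ring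
  rw [e]
  exact tail_ratio_grouped hK hZ hs hθ habc hw hW hcstar hc

end Scalar

/-! ## §2 ★★★ The reference tail from profile-number ratios -/

variable {L : ℕ} [NeZero L]

set_option maxHeartbeats 3200000 in
/-- ★★★ **THE REFERENCE TAIL `η₁` FROM PROFILE-NUMBER RATIOS.**  For every `A ≥ 0` there is `C_η = C_η(L, A) ≥ 0` such that for `β ≥ 900`, every profile `Ω` (measurable,
`0 ≤ Ω ≤ CΩ`, support in the capped balanced set with `‖v̂‖ ≤ R`), every FP window `ε > 0`, every measurable fibre core `C ⊆ {cap, ‖v̂‖ ≤ (√β)⁻¹, |v_{e,c}| ≤ (√β)⁻¹}` with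
`θ = ∫_C Ω > 0` and `I₀ = ∫Ω ≤ A·θ`, `M_{3n} = ∫Ω(√β‖v̂‖)^{3n} ≤ A·θ`, and every level `T` and tail ratio `t ≥ 0` with `∫_{T<β‖v̂‖²}Ω ≤ t·θ`, `∫_{T<β‖v̂‖²}Ω(√β‖v̂‖)^{3n} ≤ t·θ`:
`∫_{S′(T)ᶜ} ρ₁(Ω) dμP ≤ C_η·(e^{−T/2} + t)·∫ρ₁(Ω) dμP`. [cite: Luscher1983, §3] -/
theorem profile_reference_tail {A : ℝ} (hA : 0 ≤ A) :
    ∃ Cη : ℝ, 0 ≤ Cη ∧ ∀ {β : ℝ}, 900 ≤ β → ∀ {Ω : LinkSpace L → ℝ}, Measurable Ω → ∀ {CΩ : ℝ}, (∀ x, |Ω x| ≤ CΩ) → (∀ x, 0 ≤ Ω x) → ∀ {R : ℝ},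
      (∀ v : Edge 3 L → Fin 3 → ℝ, Ω (linkEmbed L v) ≠ 0 → v ∈ capBalancedSet L ∧ ‖linkEmbed L v‖ ≤ R) → ∀ {ε : ℝ}, 0 < ε →
      ∀ {C : Set (Edge 3 L → Fin 3 → ℝ)}, MeasurableSet C →
      (∀ v ∈ C, v ∈ capBalancedSet L ∧ ‖linkEmbed L v‖ ≤ (Real.sqrt β)⁻¹ ∧ ∀ (e : Edge 3 L) (c : Fin 3), |v e c| ≤ (Real.sqrt β)⁻¹) →
      0 < ∫ v in C, Ω (linkEmbed L v) ∂orthoTransverse L →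
      ∫ v, Ω (linkEmbed L v) ∂orthoTransverse L ≤ A * ∫ v in C, Ω (linkEmbed L v) ∂orthoTransverse L →
      ∫ v, Ω (linkEmbed L v) * (Real.sqrt β * ‖linkEmbed L v‖) ^ (3 * Fintype.card {x : Site 3 L // ¬x = 0}) ∂orthoTransverse L ≤ A * ∫ v in C, Ω (linkEmbed L v) ∂orthoTransverse L →
      ∀ (T : ℝ) {t : ℝ}, 0 ≤ t →
      ∫ v in {v | T < β * ‖linkEmbed L v‖ ^ 2}, Ω (linkEmbed L v) ∂orthoTransverse L ≤ t * ∫ v in C, Ω (linkEmbed L v) ∂orthoTransverse L →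
      ∫ v in {v | T < β * ‖linkEmbed L v‖ ^ 2}, Ω (linkEmbed L v) * (Real.sqrt β * ‖linkEmbed L v‖) ^ (3 * Fintype.card {x : Site 3 L // ¬x = 0}) ∂orthoTransverse L ≤
        t * ∫ v in C, Ω (linkEmbed L v) ∂orthoTransverse L →
      ∫ p in ({p : (Edge 3 L → Fin 3 → ℝ) × ((Edge 3 L → Fin 3 → ℝ) × (Site 3 L → SU2)) | β * kinDefect L (orthoTube L 1 p.1) (orthoTube L 1 p.2.1) p.2.2 ≤ T} ∩
          {p | β * ‖linkEmbed L p.1‖ ^ 2 ≤ T} ∩ {p | β * ‖linkEmbed L p.2.1‖ ^ 2 ≤ T} ∩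
          {p | Ω (linkEmbed L p.1) ≠ 0 ∧ Ω (linkEmbed L p.2.1) ≠ 0 ∧ fpWeight L ε p.2.2 ≠ 0})ᶜ,
        fpTriple L β Ω (fpWeight L ε) 1 1 p ∂((orthoTransverse L).prod ((orthoTransverse L).prod (gaugeMeasure L))) ≤
      Cη * (Real.exp (-(T / 2)) + t) * ∫ p, fpTriple L β Ω (fpWeight L ε) 1 1 p ∂((orthoTransverse L).prod ((orthoTransverse L).prod (gaugeMeasure L))) := by
  have habc0 : 0 ≤ (π ^ 2 / 12) ^ Fintype.card {x : Site 3 L // ¬x = 0} * (3 * (L : ℝ)) ^ (3 * Fintype.card {x : Site 3 L // ¬x = 0}) * 3 ^ (3 * Fintype.card {x : Site 3 L // ¬x = 0}) := by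
    positivity
  have hc50 : 0 ≤ (5 * Real.sqrt 2) ^ (3 * Fintype.card {x : Site 3 L // ¬x = 0}) + Real.sqrt 2 ^ (3 * Fintype.card {x : Site 3 L // ¬x = 0}) := by positivity
  have hcstar0 : 0 < Real.exp (-((Fintype.card (Edge 3 L) : ℝ) * (2 + 2 * Real.sqrt 2) ^ 2 + 100 * (Fintype.card (Plaquette 3 L × Fin 3) : ℝ) +
      729945 * (Fintype.card (Plaquette 3 L) : ℝ))) := Real.exp_pos _
  -- `C_η = (kinetic constant) + 2·(fibre constant)`
  refine ⟨5 * Real.exp (1 / 2) * 4 ^ (3 * Fintype.card {x : Site 3 L // ¬x = 0}) * (3 * Fintype.card {x : Site 3 L // ¬x = 0}).factorial *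
      ((π ^ 2 / 12) ^ Fintype.card {x : Site 3 L // ¬x = 0} * (3 * (L : ℝ)) ^ (3 * Fintype.card {x : Site 3 L // ¬x = 0}) * 3 ^ (3 * Fintype.card {x : Site 3 L // ¬x = 0})) *
      10 ^ Fintype.card {x : Site 3 L // ¬x = 0} *
      ((1 + ((5 * Real.sqrt 2) ^ (3 * Fintype.card {x : Site 3 L // ¬x = 0}) + Real.sqrt 2 ^ (3 * Fintype.card {x : Site 3 L // ¬x = 0}))) * A ^ 2) /
      Real.exp (-((Fintype.card (Edge 3 L) : ℝ) * (2 + 2 * Real.sqrt 2) ^ 2 + 100 * (Fintype.card (Plaquette 3 L × Fin 3) : ℝ) + 729945 * (Fintype.card (Plaquette 3 L) : ℝ))) +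
    2 * (5 * Real.exp 1 * 4 ^ (3 * Fintype.card {x : Site 3 L // ¬x = 0}) * (3 * Fintype.card {x : Site 3 L // ¬x = 0}).factorial *
      ((π ^ 2 / 12) ^ Fintype.card {x : Site 3 L // ¬x = 0} * (3 * (L : ℝ)) ^ (3 * Fintype.card {x : Site 3 L // ¬x = 0}) * 3 ^ (3 * Fintype.card {x : Site 3 L // ¬x = 0})) *
      10 ^ Fintype.card {x : Site 3 L // ¬x = 0} *
      ((1 + ((5 * Real.sqrt 2) ^ (3 * Fintype.card {x : Site 3 L // ¬x = 0}) + Real.sqrt 2 ^ (3 * Fintype.card {x : Site 3 L // ¬x = 0}))) * A) /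
      Real.exp (-((Fintype.card (Edge 3 L) : ℝ) * (2 + 2 * Real.sqrt 2) ^ 2 + 100 * (Fintype.card (Plaquette 3 L × Fin 3) : ℝ) + 729945 * (Fintype.card (Plaquette 3 L) : ℝ)))),
    by positivity, ?_⟩
  intro β hβ Ω hΩm CΩ hCΩ hΩ0 R hΩt ε hε C hC hCsub hθ hI hM T t ht htail0 htail3
  haveI := isFiniteMeasure_orthoTransverse L
  haveI : SecondCountableTopology SU2 := secondCountableTopology_su2
  obtain ⟨hs0, hs30, hs1, hβs, hβ0⟩ := inv_sqrt_window hβ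
  have hfpZ : 0 < fpZ ε := fpZ_pos hε
  -- the three bricks
  have h1 := reference_tail_le (L := L) hβ0 hΩm hCΩ hΩ0 hΩt hC hs30 hCsub hθ hε hs0 hs1 T
  have h2 := reference_fibre_tail_le (L := L) hβ0 hΩm hCΩ hΩ0 hΩt hC hs30 hCsub hθ hε hs0 hs1 T
  have h3 := reference_fibre_tail_le' (L := L) hβ0 hΩm hCΩ hΩ0 hΩt hC hs30 hCsub hθ hε hs0 hs1 T
  -- scaled moments and tails are multiples of the plain ones
  have eM5 : ∫ v, Ω (linkEmbed L v) * (Real.sqrt β * (5 * (Real.sqrt 2 * ‖linkEmbed L v‖))) ^ (3 * Fintype.card {x : Site 3 L // ¬x = 0}) ∂orthoTransverse L =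
      (5 * Real.sqrt 2) ^ (3 * Fintype.card {x : Site 3 L // ¬x = 0}) * ∫ v, Ω (linkEmbed L v) * (Real.sqrt β * ‖linkEmbed L v‖) ^ (3 * Fintype.card {x : Site 3 L // ¬x = 0}) ∂orthoTransverse L := by
    rw [← integral_const_mul]
    refine integral_congr_ae (ae_of_all _ fun v => ?_)
    dsimp only
    rw [show Real.sqrt β * (5 * (Real.sqrt 2 * ‖linkEmbed L v‖)) = (5 * Real.sqrt 2) * (Real.sqrt β * ‖linkEmbed L v‖) by ring, mul_pow]; ring
  have eM2 : ∫ v, Ω (linkEmbed L v) * (Real.sqrt β * (Real.sqrt 2 * ‖linkEmbed L v‖)) ^ (3 * Fintype.card {x : Site 3 L // ¬x = 0}) ∂orthoTransverse L =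
      Real.sqrt 2 ^ (3 * Fintype.card {x : Site 3 L // ¬x = 0}) * ∫ v, Ω (linkEmbed L v) * (Real.sqrt β * ‖linkEmbed L v‖) ^ (3 * Fintype.card {x : Site 3 L // ¬x = 0}) ∂orthoTransverse L := by
    rw [← integral_const_mul]
    refine integral_congr_ae (ae_of_all _ fun v => ?_)
    dsimp only
    rw [show Real.sqrt β * (Real.sqrt 2 * ‖linkEmbed L v‖) = Real.sqrt 2 * (Real.sqrt β * ‖linkEmbed L v‖) by ring, mul_pow]; ring
  have eT5 : ∫ v in {v | T < β * ‖linkEmbed L v‖ ^ 2}, Ω (linkEmbed L v) * (Real.sqrt β * (5 * (Real.sqrt 2 * ‖linkEmbed L v‖))) ^ (3 * Fintype.card {x : Site 3 L // ¬x = 0}) ∂orthoTransverse L =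
      (5 * Real.sqrt 2) ^ (3 * Fintype.card {x : Site 3 L // ¬x = 0}) *
        ∫ v in {v | T < β * ‖linkEmbed L v‖ ^ 2}, Ω (linkEmbed L v) * (Real.sqrt β * ‖linkEmbed L v‖) ^ (3 * Fintype.card {x : Site 3 L // ¬x = 0}) ∂orthoTransverse L := by
    rw [← integral_const_mul]
    refine integral_congr_ae (ae_of_all _ fun v => ?_)
    dsimp only
    rw [show Real.sqrt β * (5 * (Real.sqrt 2 * ‖linkEmbed L v‖)) = (5 * Real.sqrt 2) * (Real.sqrt β * ‖linkEmbed L v‖) by ring, mul_pow]; ring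
  have eT2 : ∫ v in {v | T < β * ‖linkEmbed L v‖ ^ 2}, Ω (linkEmbed L v) * (Real.sqrt β * (Real.sqrt 2 * ‖linkEmbed L v‖)) ^ (3 * Fintype.card {x : Site 3 L // ¬x = 0}) ∂orthoTransverse L =
      Real.sqrt 2 ^ (3 * Fintype.card {x : Site 3 L // ¬x = 0}) *
        ∫ v in {v | T < β * ‖linkEmbed L v‖ ^ 2}, Ω (linkEmbed L v) * (Real.sqrt β * ‖linkEmbed L v‖) ^ (3 * Fintype.card {x : Site 3 L // ¬x = 0}) ∂orthoTransverse L := by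
    rw [← integral_const_mul]
    refine integral_congr_ae (ae_of_all _ fun v => ?_)
    dsimp only
    rw [show Real.sqrt β * (Real.sqrt 2 * ‖linkEmbed L v‖) = Real.sqrt 2 * (Real.sqrt β * ‖linkEmbed L v‖) by ring, mul_pow]; ring
  rw [eM2, eT5] at h2
  rw [eM5, eT2] at h3
  have hcore := reference_core_tail_le (L := L) hΩm hCΩ hΩ0 ε T h1 h2 h3
  -- abbreviations (after the bricks)
  set n : ℕ := Fintype.card {x : Site 3 L // ¬x = 0} with hn
  set s : ℝ := (Real.sqrt β)⁻¹ with hs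
  set c5 : ℝ := (5 * Real.sqrt 2) ^ (3 * n) + Real.sqrt 2 ^ (3 * n) with hc5
  set cstar : ℝ := Real.exp (-((Fintype.card (Edge 3 L) : ℝ) * (2 + 2 * Real.sqrt 2) ^ 2 + 100 * (Fintype.card (Plaquette 3 L × Fin 3) : ℝ) +
    729945 * (Fintype.card (Plaquette 3 L) : ℝ))) with hcstar
  set c₁ : ℝ := Real.exp (-(β * ((Fintype.card (Edge 3 L) : ℝ) * (2 * s + 2 * Real.sqrt 2 * s) ^ 2)) -
        β / 2 * (((10 * Real.sqrt (Fintype.card (Plaquette 3 L × Fin 3)) * s) ^ 2 + stepActionErr (L := L) s 0) +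
          ((10 * Real.sqrt (Fintype.card (Plaquette 3 L × Fin 3)) * s) ^ 2 + stepActionErr (L := L) s 0))) with hc₁
  set I₀ : ℝ := ∫ v, Ω (linkEmbed L v) ∂orthoTransverse L with hI₀
  set Mm : ℝ := ∫ v, Ω (linkEmbed L v) * (Real.sqrt β * ‖linkEmbed L v‖) ^ (3 * n) ∂orthoTransverse L with hMm
  set θ : ℝ := ∫ v in C, Ω (linkEmbed L v) ∂orthoTransverse L with hθdef
  set τ₀ : ℝ := ∫ v in {v | T < β * ‖linkEmbed L v‖ ^ 2}, Ω (linkEmbed L v) ∂orthoTransverse L with hτ₀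
  set τ₃ : ℝ := ∫ v in {v | T < β * ‖linkEmbed L v‖ ^ 2}, Ω (linkEmbed L v) * (Real.sqrt β * ‖linkEmbed L v‖) ^ (3 * n) ∂orthoTransverse L with hτ₃
  set Z : ℝ := fpZ ε with hZ
  set abc : ℝ := (π ^ 2 / 12) ^ n * (3 * (L : ℝ)) ^ (3 * n) * 3 ^ (3 * n) with habc
  set Kk : ℝ := 5 * Real.exp (1 / 2) * 4 ^ (3 * n) * (3 * n).factorial with hKk
  set Kf : ℝ := 5 * Real.exp 1 * 4 ^ (3 * n) * (3 * n).factorial with hKf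
  have hKk0 : 0 ≤ Kk := by rw [hKk]; positivity
  have hKf0 : 0 ≤ Kf := by rw [hKf]; positivity
  have hc₁ge : cstar ≤ c₁ := floorConst_le (L := L) hβ
  have hI0 : 0 ≤ I₀ := integral_nonneg fun v => hΩ0 _
  have hM0 : 0 ≤ Mm := integral_nonneg fun v => mul_nonneg (hΩ0 _) (by positivity)
  have hτ₀0 : 0 ≤ τ₀ := by rw [hτ₀]; exact integral_nonneg fun v => hΩ0 _
  have hτ₃0 : 0 ≤ τ₃ := by rw [hτ₃]; exact integral_nonneg fun v => mul_nonneg (hΩ0 _) (by positivity)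
  have hp5 : 0 ≤ (5 * Real.sqrt 2) ^ (3 * n) := by positivity
  have hp2 : 0 ≤ Real.sqrt 2 ^ (3 * n) := by positivity
  -- the three numerators against `θ²`
  have hW1 : I₀ ^ 2 + c5 * I₀ * Mm ≤ (1 + c5) * A ^ 2 * θ ^ 2 := by
    have h1' : I₀ ^ 2 ≤ (A * θ) ^ 2 := pow_le_pow_left₀ hI0 hI 2
    have h2' : I₀ * Mm ≤ (A * θ) * (A * θ) := mul_le_mul hI hM hM0 (by positivity)
    have hc50' : 0 ≤ c5 := hc50
    nlinarith [mul_le_mul_of_nonneg_left h2' hc50']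
  have hW2 : τ₀ * I₀ + (5 * Real.sqrt 2) ^ (3 * n) * τ₃ * I₀ + τ₀ * (Real.sqrt 2 ^ (3 * n) * Mm) ≤ (1 + c5) * A * t * θ ^ 2 := by
    have h1' : τ₀ * I₀ ≤ (t * θ) * (A * θ) := mul_le_mul htail0 hI hI0 (by positivity)
    have h2' : τ₃ * I₀ ≤ (t * θ) * (A * θ) := mul_le_mul htail3 hI hI0 (by positivity)
    have h3' : τ₀ * Mm ≤ (t * θ) * (A * θ) := mul_le_mul htail0 hM hM0 (by positivity)
    have e : c5 = (5 * Real.sqrt 2) ^ (3 * n) + Real.sqrt 2 ^ (3 * n) := hc5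
    nlinarith [mul_le_mul_of_nonneg_left h2' hp5, mul_le_mul_of_nonneg_left h3' hp2]
  have hW3 : τ₀ * I₀ + τ₀ * ((5 * Real.sqrt 2) ^ (3 * n) * Mm) + Real.sqrt 2 ^ (3 * n) * τ₃ * I₀ ≤ (1 + c5) * A * t * θ ^ 2 := by
    have h1' : τ₀ * I₀ ≤ (t * θ) * (A * θ) := mul_le_mul htail0 hI hI0 (by positivity)
    have h2' : τ₀ * Mm ≤ (t * θ) * (A * θ) := mul_le_mul htail0 hM hM0 (by positivity)
    have h3' : τ₃ * I₀ ≤ (t * θ) * (A * θ) := mul_le_mul htail3 hI hI0 (by positivity)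
    have e : c5 = (5 * Real.sqrt 2) ^ (3 * n) + Real.sqrt 2 ^ (3 * n) := hc5
    nlinarith [mul_le_mul_of_nonneg_left h2' hp5, mul_le_mul_of_nonneg_left h3' hp2]
  -- the three coefficients
  have hη1 : Real.exp (-(T / 2)) * (Kk * (Z * (abc * s ^ (3 * n)) * (I₀ ^ 2 + c5 * I₀ * Mm))) / (c₁ * (Z * (s ^ 3 / 10) ^ n * θ ^ 2)) ≤
      Real.exp (-(T / 2)) * (Kk * abc * 10 ^ n * ((1 + c5) * A ^ 2) / cstar) := by
    rw [mul_div_assoc]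
    refine mul_le_mul_of_nonneg_left ?_ (Real.exp_pos _).le
    have h := tail_ratio_grouped (n := n) (a := (π ^ 2 / 12) ^ n) (b := (3 * (L : ℝ)) ^ (3 * n)) (c := (3 : ℝ) ^ (3 * n)) hKk0 hfpZ hs0 hθ (by positivity)
      (by positivity : (0 : ℝ) ≤ (1 + c5) * A ^ 2) hW1 hcstar0 hc₁ge
    rw [habc]; exact h
  have hη2 : Kf * (Z * (π ^ 2 / 12) ^ n * (3 * (L : ℝ)) ^ (3 * n) * 3 ^ (3 * n) * s ^ (3 * n)) *
      (τ₀ * I₀ + (5 * Real.sqrt 2) ^ (3 * n) * τ₃ * I₀ + τ₀ * (Real.sqrt 2 ^ (3 * n) * Mm)) / (c₁ * (Z * (s ^ 3 / 10) ^ n * θ ^ 2)) ≤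
      Kf * abc * 10 ^ n * ((1 + c5) * A * t) / cstar := by
    have h := tail_ratio_flat (n := n) (a := (π ^ 2 / 12) ^ n) (b := (3 * (L : ℝ)) ^ (3 * n)) (c := (3 : ℝ) ^ (3 * n)) hKf0 hfpZ hs0 hθ (by positivity)
      (by positivity : (0 : ℝ) ≤ (1 + c5) * A * t) hW2 hcstar0 hc₁ge
    rw [habc]; exact h
  have hη3 : Kf * (Z * (π ^ 2 / 12) ^ n * (3 * (L : ℝ)) ^ (3 * n) * 3 ^ (3 * n) * s ^ (3 * n)) *
      (τ₀ * I₀ + τ₀ * ((5 * Real.sqrt 2) ^ (3 * n) * Mm) + Real.sqrt 2 ^ (3 * n) * τ₃ * I₀) / (c₁ * (Z * (s ^ 3 / 10) ^ n * θ ^ 2)) ≤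
      Kf * abc * 10 ^ n * ((1 + c5) * A * t) / cstar := by
    have h := tail_ratio_flat (n := n) (a := (π ^ 2 / 12) ^ n) (b := (3 * (L : ℝ)) ^ (3 * n)) (c := (3 : ℝ) ^ (3 * n)) hKf0 hfpZ hs0 hθ (by positivity)
      (by positivity : (0 : ℝ) ≤ (1 + c5) * A * t) hW3 hcstar0 hc₁ge
    rw [habc]; exact h
  -- assemble
  refine hcore.trans (mul_le_mul_of_nonneg_right ?_ (integral_nonneg fun p => ?_))
  swap
  · unfold fpTriple; exact mul_nonneg (hΩ0 _) (mul_nonneg (mul_nonneg (fpWeight_mem_Icc L ε _).1 (transferKernel_pos _ _ _ _).le) (hΩ0 _))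
  have hexp1 : Real.exp (-(T / 2)) * (Kk * abc * 10 ^ n * ((1 + c5) * A ^ 2) / cstar) ≤
      (Kk * abc * 10 ^ n * ((1 + c5) * A ^ 2) / cstar + 2 * (Kf * abc * 10 ^ n * ((1 + c5) * A) / cstar)) * Real.exp (-(T / 2)) := by
    have h0 : 0 ≤ Kf * abc * 10 ^ n * ((1 + c5) * A) / cstar := by positivity
    nlinarith [Real.exp_pos (-(T / 2))]
  have ht1 : Kf * abc * 10 ^ n * ((1 + c5) * A * t) / cstar + Kf * abc * 10 ^ n * ((1 + c5) * A * t) / cstar ≤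
      (Kk * abc * 10 ^ n * ((1 + c5) * A ^ 2) / cstar + 2 * (Kf * abc * 10 ^ n * ((1 + c5) * A) / cstar)) * t := by
    have h0 : 0 ≤ Kk * abc * 10 ^ n * ((1 + c5) * A ^ 2) / cstar := by positivity
    have e : Kf * abc * 10 ^ n * ((1 + c5) * A * t) / cstar = (Kf * abc * 10 ^ n * ((1 + c5) * A) / cstar) * t := by ring
    rw [e]; nlinarith
  calc Real.exp (-(T / 2)) * (Kk * (Z * (abc * s ^ (3 * n)) * (I₀ ^ 2 + c5 * I₀ * Mm))) / (c₁ * (Z * (s ^ 3 / 10) ^ n * θ ^ 2)) +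
        Kf * (Z * (π ^ 2 / 12) ^ n * (3 * (L : ℝ)) ^ (3 * n) * 3 ^ (3 * n) * s ^ (3 * n)) *
          (τ₀ * I₀ + (5 * Real.sqrt 2) ^ (3 * n) * τ₃ * I₀ + τ₀ * (Real.sqrt 2 ^ (3 * n) * Mm)) / (c₁ * (Z * (s ^ 3 / 10) ^ n * θ ^ 2)) +
        Kf * (Z * (π ^ 2 / 12) ^ n * (3 * (L : ℝ)) ^ (3 * n) * 3 ^ (3 * n) * s ^ (3 * n)) *
          (τ₀ * I₀ + τ₀ * ((5 * Real.sqrt 2) ^ (3 * n) * Mm) + Real.sqrt 2 ^ (3 * n) * τ₃ * I₀) / (c₁ * (Z * (s ^ 3 / 10) ^ n * θ ^ 2))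
      ≤ Real.exp (-(T / 2)) * (Kk * abc * 10 ^ n * ((1 + c5) * A ^ 2) / cstar) +
          Kf * abc * 10 ^ n * ((1 + c5) * A * t) / cstar + Kf * abc * 10 ^ n * ((1 + c5) * A * t) / cstar := add_le_add (add_le_add hη1 hη2) hη3
    _ ≤ (Kk * abc * 10 ^ n * ((1 + c5) * A ^ 2) / cstar + 2 * (Kf * abc * 10 ^ n * ((1 + c5) * A) / cstar)) * (Real.exp (-(T / 2)) + t) := by
          rw [mul_add]; linarith

end Summit.QuantumFields.YangMills.Theorems.FemtoTransferGap.RateTube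

end
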